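import Literature.NumberTheory.Automorphic.AdelicTensorStripping
import Literature.NumberTheory.Automorphic.AdelicSchwartzBruhatLF
import HarnessLib

/-!
# Archimedean tensor stripping in the continuous category

Topic `NumberTheory/Automorphic`; namespace `Literature.NumberTheory.Automorphic`. Origin: `pub-hodgecm`
MODEL-CONSTRUCTION sub-cell, junction (S-∞) ∘ (α′) of RULING J-W2glob-7. KERNEL MATHEMATICS ONLY: every declaration
below is proved; no `def … : Prop` record, no cited hypothesis.

`AdelicTensorStripping` proves, by pure algebra and adelic Fourier inversion, that a linear endomorphism `M` of
`𝒮(𝔸_K^ι)` commuting with the finite Heisenberg translations and modulations is `archPart M ⊗ 1`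
(`eq_adelicTensorEnd_archPart_id`). `AdelicSchwartzBruhatLF` defines LF-continuity (`IsLFContinuous`) and proves
that a stripped archimedean factor of an LF-continuous operator is continuous (`IsLFContinuous.continuous_of_tmul`).
This file joins the two:

* `IsLFContinuous.continuous_archFactor`, `IsLFContinuous.continuous_archPart` — the archimedean factor / part of
  an LF-continuous `M` is a continuous operator of the Fréchet space `𝓢((K ⊗ ℝ)^ι)`; `archPartCLM` bundles it;
* `isLFContinuous_and_comm_iff` — `M` is LF-continuous and commutes with the finite Heisenberg operators iff
  `M = A ⊗ 1` with `A : 𝓢 →L[ℂ] 𝓢`;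
* `exists_continuousLinearEquiv_of_mem_lfUnits` — an LF-unit (`lfUnits`: `M`, `M⁻¹` LF-continuous) commuting
  with the finite Heisenberg operators is `A ⊗ 1` with `A` a TOPOLOGICAL AUTOMORPHISM `𝓢 ≃L[ℂ] 𝓢` and
  `M⁻¹ = A⁻¹ ⊗ 1` — the shape `s(g_∞, 1) = A(g_∞) ⊗ 1` of an adelic metaplectic operator over an archimedean
  element ([Weil1964, Chap. III n° 37–39]; [GelbartRogawski1991, §3.1 p. 454]).

## References

* [Weil1964] A. Weil, *Sur certains groupes d'opérateurs unitaires*, Acta Math. 111 (1964), Chap. I n° 11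
  p. 155–156, Chap. III n° 37–39.
* [GelbartRogawski1991] S. Gelbart, J. Rogawski, *L-functions and Fourier–Jacobi coefficients for the unitary
  group U(3)*, Invent. math. 105 (1991), §3.1 p. 454.
-/

noncomputable section

open NumberField NumberField.InfinitePlace NumberField.mixedEmbedding IsDedekindDomain
open scoped SchwartzMap TensorProduct Classical

namespace Literature.NumberTheory.Automorphic

variable {K : Type} [Field K] [NumberField K] {ι : Type} [Fintype ι]

variable (K ι) in
/-- Evaluation at a finite point, as a linear functional on `𝒮((𝔸_K^∞)^ι)`. [folklore] -/
def finEvalLM (b : ι → FiniteAdeleRing (𝓞 K) K) : FinSB K ι →ₗ[ℂ] ℂ where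
  toFun f := (f : (ι → FiniteAdeleRing (𝓞 K) K) → ℂ) b
  map_add' _ _ := rfl
  map_smul' _ _ := rfl

omit [Fintype ι] in
/-- Unfolding of `finEvalLM`. [folklore] -/
@[simp] theorem finEvalLM_apply (b : ι → FiniteAdeleRing (𝓞 K) K) (f : FinSB K ι) :
    finEvalLM K ι b f = (f : (ι → FiniteAdeleRing (𝓞 K) K) → ℂ) b := rfl

omit [Fintype ι] in
/-- `ev₀ 𝟙_L = 1`. [folklore] -/
theorem finEvalLM_zero_indicatorSB (L : AddSubgroup (ι → FiniteAdeleRing (𝓞 K) K))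
    (hLo : IsOpen (L : Set (ι → FiniteAdeleRing (𝓞 K) K)))
    (hLc : IsCompact (L : Set (ι → FiniteAdeleRing (𝓞 K) K))) :
    finEvalLM K ι 0 (indicatorSB K ι L hLo hLc) = 1 := by
  rw [finEvalLM_apply, coe_indicatorSB,
    Set.indicator_of_mem (show (0 : ι → FiniteAdeleRing (𝓞 K) K) ∈ (L : Set _) from L.zero_mem)]

variable (M : ↥(piSchwartzBruhat K ι) →ₗ[ℂ] ↥(piSchwartzBruhat K ι))

/-- For LF-continuous `M` commuting with the translations by `L` and the modulations by `L^♮`, the archimedean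
factor at `L` is the LF block at `(𝟙_L, ev₀)` and is CONTINUOUS. [folklore] -/
theorem IsLFContinuous.coe_archFactor_eq_and_continuous (hLF : IsLFContinuous M)
    (L : AddSubgroup (ι → FiniteAdeleRing (𝓞 K) K)) (hLo : IsOpen (L : Set (ι → FiniteAdeleRing (𝓞 K) K)))
    (hLc : IsCompact (L : Set (ι → FiniteAdeleRing (𝓞 K) K)))
    (hT : ∀ k ∈ L, M ∘ₗ translateLM K ι (piAdeleSplit K ι (0, k)) =
      translateLM K ι (piAdeleSplit K ι (0, k)) ∘ₗ M)
    (hM : ∀ y ∈ dualBox K ι L, M ∘ₗ modulateLM K ι (piAdeleSplit K ι (0, y)) =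
      modulateLM K ι (piAdeleSplit K ι (0, y)) ∘ₗ M) :
    ⇑(archFactor M L hLo hLc) = ⇑(lfBlock M (indicatorSB K ι L hLo hLc) (finEvalLM K ι 0)) ∧
      Continuous (archFactor M L hLo hLc) :=
  hLF.continuous_of_tmul (finEvalLM_zero_indicatorSB L hLo hLc) (A := ⇑(archFactor M L hLo hLc))
    (map_tmul_indicatorSB M L hLo hLc hT hM)

/-- **Continuity of the archimedean factor** of an LF-continuous `M`. [folklore] -/
theorem IsLFContinuous.continuous_archFactor (hLF : IsLFContinuous M)
    (L : AddSubgroup (ι → FiniteAdeleRing (𝓞 K) K)) (hLo : IsOpen (L : Set (ι → FiniteAdeleRing (𝓞 K) K)))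
    (hLc : IsCompact (L : Set (ι → FiniteAdeleRing (𝓞 K) K)))
    (hT : ∀ k ∈ L, M ∘ₗ translateLM K ι (piAdeleSplit K ι (0, k)) =
      translateLM K ι (piAdeleSplit K ι (0, k)) ∘ₗ M)
    (hM : ∀ y ∈ dualBox K ι L, M ∘ₗ modulateLM K ι (piAdeleSplit K ι (0, y)) =
      modulateLM K ι (piAdeleSplit K ι (0, y)) ∘ₗ M) :
    Continuous (archFactor M L hLo hLc) :=
  (hLF.coe_archFactor_eq_and_continuous M L hLo hLc hT hM).2

/-- **Continuity of the archimedean part** of an LF-continuous `M` commuting with all finite Heisenberg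
operators. [folklore] -/
theorem IsLFContinuous.continuous_archPart (hLF : IsLFContinuous M)
    (hT : ∀ k, M ∘ₗ translateLM K ι (piAdeleSplit K ι (0, k)) =
      translateLM K ι (piAdeleSplit K ι (0, k)) ∘ₗ M)
    (hM : ∀ y, M ∘ₗ modulateLM K ι (piAdeleSplit K ι (0, y)) =
      modulateLM K ι (piAdeleSplit K ι (0, y)) ∘ₗ M) :
    Continuous (archPart M) :=
  hLF.continuous_archFactor M _ _ _ (fun k _ => hT k) (fun y _ => hM y)

/-- **The archimedean part as a continuous operator** of `𝓢((K ⊗ ℝ)^ι)`. [folklore] -/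
def archPartCLM (hLF : IsLFContinuous M)
    (hT : ∀ k, M ∘ₗ translateLM K ι (piAdeleSplit K ι (0, k)) =
      translateLM K ι (piAdeleSplit K ι (0, k)) ∘ₗ M)
    (hM : ∀ y, M ∘ₗ modulateLM K ι (piAdeleSplit K ι (0, y)) =
      modulateLM K ι (piAdeleSplit K ι (0, y)) ∘ₗ M) :
    𝓢((ι → mixedSpace K), ℂ) →L[ℂ] 𝓢((ι → mixedSpace K), ℂ) :=
  { archPart M with cont := hLF.continuous_archPart M hT hM }

/-- `archPartCLM` as a linear map is `archPart`. [folklore] -/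
@[simp] theorem coe_archPartCLM (hLF : IsLFContinuous M)
    (hT : ∀ k, M ∘ₗ translateLM K ι (piAdeleSplit K ι (0, k)) =
      translateLM K ι (piAdeleSplit K ι (0, k)) ∘ₗ M)
    (hM : ∀ y, M ∘ₗ modulateLM K ι (piAdeleSplit K ι (0, y)) =
      modulateLM K ι (piAdeleSplit K ι (0, y)) ∘ₗ M) :
    (archPartCLM M hLF hT hM : 𝓢((ι → mixedSpace K), ℂ) →ₗ[ℂ] 𝓢((ι → mixedSpace K), ℂ)) = archPart M := rfl

/-- `archPartCLM` on points. [folklore] -/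
theorem archPartCLM_apply (hLF : IsLFContinuous M)
    (hT : ∀ k, M ∘ₗ translateLM K ι (piAdeleSplit K ι (0, k)) =
      translateLM K ι (piAdeleSplit K ι (0, k)) ∘ₗ M)
    (hM : ∀ y, M ∘ₗ modulateLM K ι (piAdeleSplit K ι (0, y)) =
      modulateLM K ι (piAdeleSplit K ι (0, y)) ∘ₗ M) (φ : 𝓢((ι → mixedSpace K), ℂ)) :
    archPartCLM M hLF hT hM φ = archPart M φ := rfl

/-- **`M = archPartCLM M ⊗ 1`** for LF-continuous `M` commuting with the finite Heisenberg operators. [folklore] -/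
theorem IsLFContinuous.eq_adelicTensorEnd_archPartCLM_id (hLF : IsLFContinuous M)
    (hT : ∀ k, M ∘ₗ translateLM K ι (piAdeleSplit K ι (0, k)) =
      translateLM K ι (piAdeleSplit K ι (0, k)) ∘ₗ M)
    (hM : ∀ y, M ∘ₗ modulateLM K ι (piAdeleSplit K ι (0, y)) =
      modulateLM K ι (piAdeleSplit K ι (0, y)) ∘ₗ M) :
    M = adelicTensorEnd
      (archPartCLM M hLF hT hM : 𝓢((ι → mixedSpace K), ℂ) →ₗ[ℂ] 𝓢((ι → mixedSpace K), ℂ)) LinearMap.id :=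
  eq_adelicTensorEnd_archPart_id M hT hM

/-- **(S-∞) in the continuous category**: `M` is LF-continuous and commutes with every finite Heisenberg
translation and modulation iff `M = A ⊗ 1` for a continuous operator `A` of `𝓢((K ⊗ ℝ)^ι)`. [folklore] -/
theorem isLFContinuous_and_comm_iff :
    (IsLFContinuous M ∧
      (∀ k, M ∘ₗ translateLM K ι (piAdeleSplit K ι (0, k)) =
        translateLM K ι (piAdeleSplit K ι (0, k)) ∘ₗ M) ∧
      ∀ y, M ∘ₗ modulateLM K ι (piAdeleSplit K ι (0, y)) =
        modulateLM K ι (piAdeleSplit K ι (0, y)) ∘ₗ M) ↔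
    ∃ A : 𝓢((ι → mixedSpace K), ℂ) →L[ℂ] 𝓢((ι → mixedSpace K), ℂ),
      M = adelicTensorEnd (A : 𝓢((ι → mixedSpace K), ℂ) →ₗ[ℂ] 𝓢((ι → mixedSpace K), ℂ)) LinearMap.id := by
  constructor
  · rintro ⟨hLF, hT, hM⟩
    exact ⟨archPartCLM M hLF hT hM, hLF.eq_adelicTensorEnd_archPartCLM_id M hT hM⟩
  · rintro ⟨A, rfl⟩
    exact ⟨isLFContinuous_adelicTensorEnd A _, adelicTensorEnd_id_comm_translateLM _,
      adelicTensorEnd_id_comm_modulateLM _⟩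

/-- The inverse of an automorphism commuting with an operator commutes with it. [folklore] -/
theorem symm_comp_eq_of_comp_eq (N : ↥(piSchwartzBruhat K ι) ≃ₗ[ℂ] ↥(piSchwartzBruhat K ι))
    (T : ↥(piSchwartzBruhat K ι) →ₗ[ℂ] ↥(piSchwartzBruhat K ι))
    (h : (N : ↥(piSchwartzBruhat K ι) →ₗ[ℂ] ↥(piSchwartzBruhat K ι)) ∘ₗ T =
      T ∘ₗ (N : ↥(piSchwartzBruhat K ι) →ₗ[ℂ] ↥(piSchwartzBruhat K ι))) :
    (N.symm : ↥(piSchwartzBruhat K ι) →ₗ[ℂ] ↥(piSchwartzBruhat K ι)) ∘ₗ T =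
      T ∘ₗ (N.symm : ↥(piSchwartzBruhat K ι) →ₗ[ℂ] ↥(piSchwartzBruhat K ι)) := by
  apply LinearMap.ext
  intro Φ
  have hΦ := LinearMap.congr_fun h (N.symm Φ)
  simp only [LinearMap.coe_comp, Function.comp_apply, LinearEquiv.coe_coe, LinearEquiv.apply_symm_apply] at hΦ ⊢
  apply N.injective
  rw [LinearEquiv.apply_symm_apply]
  exact hΦ.symm

/-- **LF-units over archimedean elements are `A ⊗ 1` with `A` a topological automorphism**: for `M ∈ lfUnits`
(`M`, `M⁻¹` LF-continuous) commuting with every finite Heisenberg translation and modulation there is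
`A : 𝓢((K ⊗ ℝ)^ι) ≃L[ℂ] 𝓢((K ⊗ ℝ)^ι)` with `M = A ⊗ 1` and `M⁻¹ = A⁻¹ ⊗ 1`. [folklore] -/
theorem exists_continuousLinearEquiv_of_mem_lfUnits
    (N : ↥(piSchwartzBruhat K ι) ≃ₗ[ℂ] ↥(piSchwartzBruhat K ι)) (hN : N ∈ lfUnits K ι)
    (hT : ∀ k, (N : ↥(piSchwartzBruhat K ι) →ₗ[ℂ] ↥(piSchwartzBruhat K ι)) ∘ₗ
        translateLM K ι (piAdeleSplit K ι (0, k)) =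
      translateLM K ι (piAdeleSplit K ι (0, k)) ∘ₗ (N : ↥(piSchwartzBruhat K ι) →ₗ[ℂ] ↥(piSchwartzBruhat K ι)))
    (hM : ∀ y, (N : ↥(piSchwartzBruhat K ι) →ₗ[ℂ] ↥(piSchwartzBruhat K ι)) ∘ₗ
        modulateLM K ι (piAdeleSplit K ι (0, y)) =
      modulateLM K ι (piAdeleSplit K ι (0, y)) ∘ₗ (N : ↥(piSchwartzBruhat K ι) →ₗ[ℂ] ↥(piSchwartzBruhat K ι))) :
    ∃ A : 𝓢((ι → mixedSpace K), ℂ) ≃L[ℂ] 𝓢((ι → mixedSpace K), ℂ),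
      (N : ↥(piSchwartzBruhat K ι) →ₗ[ℂ] ↥(piSchwartzBruhat K ι)) =
          adelicTensorEnd (A : 𝓢((ι → mixedSpace K), ℂ) →ₗ[ℂ] 𝓢((ι → mixedSpace K), ℂ)) LinearMap.id ∧
        (N.symm : ↥(piSchwartzBruhat K ι) →ₗ[ℂ] ↥(piSchwartzBruhat K ι)) =
          adelicTensorEnd (A.symm : 𝓢((ι → mixedSpace K), ℂ) →ₗ[ℂ] 𝓢((ι → mixedSpace K), ℂ)) LinearMap.id := by
  have hT' : ∀ k, (N.symm : ↥(piSchwartzBruhat K ι) →ₗ[ℂ] ↥(piSchwartzBruhat K ι)) ∘ₗ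
      translateLM K ι (piAdeleSplit K ι (0, k)) =
      translateLM K ι (piAdeleSplit K ι (0, k)) ∘ₗ
        (N.symm : ↥(piSchwartzBruhat K ι) →ₗ[ℂ] ↥(piSchwartzBruhat K ι)) :=
    fun k => symm_comp_eq_of_comp_eq N _ (hT k)
  have hM' : ∀ y, (N.symm : ↥(piSchwartzBruhat K ι) →ₗ[ℂ] ↥(piSchwartzBruhat K ι)) ∘ₗ
      modulateLM K ι (piAdeleSplit K ι (0, y)) =
      modulateLM K ι (piAdeleSplit K ι (0, y)) ∘ₗ
        (N.symm : ↥(piSchwartzBruhat K ι) →ₗ[ℂ] ↥(piSchwartzBruhat K ι)) :=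
    fun y => symm_comp_eq_of_comp_eq N _ (hM y)
  set A := archPartCLM (N : ↥(piSchwartzBruhat K ι) →ₗ[ℂ] ↥(piSchwartzBruhat K ι)) hN.1 hT hM with hA
  set A' := archPartCLM (N.symm : ↥(piSchwartzBruhat K ι) →ₗ[ℂ] ↥(piSchwartzBruhat K ι)) hN.2 hT' hM' with hA'
  have h1 := hN.1.eq_adelicTensorEnd_archPartCLM_id _ hT hM
  have h2 := hN.2.eq_adelicTensorEnd_archPartCLM_id _ hT' hM'
  rw [← hA] at h1
  rw [← hA'] at h2
  -- `A ∘ A' = 1` and `A' ∘ A = 1` from `N ∘ N⁻¹ = 1`, `N⁻¹ ∘ N = 1` and injectivity of `A ↦ A ⊗ 1`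
  have hNN' : (N : ↥(piSchwartzBruhat K ι) →ₗ[ℂ] ↥(piSchwartzBruhat K ι)) ∘ₗ
      (N.symm : ↥(piSchwartzBruhat K ι) →ₗ[ℂ] ↥(piSchwartzBruhat K ι)) = LinearMap.id :=
    LinearMap.ext fun Φ => N.apply_symm_apply Φ
  have hN'N : (N.symm : ↥(piSchwartzBruhat K ι) →ₗ[ℂ] ↥(piSchwartzBruhat K ι)) ∘ₗ
      (N : ↥(piSchwartzBruhat K ι) →ₗ[ℂ] ↥(piSchwartzBruhat K ι)) = LinearMap.id :=
    LinearMap.ext fun Φ => N.symm_apply_apply Φ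
  have hAA' : (A : 𝓢((ι → mixedSpace K), ℂ) →ₗ[ℂ] 𝓢((ι → mixedSpace K), ℂ)) ∘ₗ
      (A' : 𝓢((ι → mixedSpace K), ℂ) →ₗ[ℂ] 𝓢((ι → mixedSpace K), ℂ)) = LinearMap.id := by
    apply adelicTensorEnd_id_injective (K := K)
    show adelicTensorEnd _ LinearMap.id = adelicTensorEnd LinearMap.id LinearMap.id
    rw [← LinearMap.id_comp (LinearMap.id : FinSB K ι →ₗ[ℂ] FinSB K ι), adelicTensorEnd_comp, ← h1, ← h2, hNN',
      LinearMap.id_comp, adelicTensorEnd_id]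
  have hA'A : (A' : 𝓢((ι → mixedSpace K), ℂ) →ₗ[ℂ] 𝓢((ι → mixedSpace K), ℂ)) ∘ₗ
      (A : 𝓢((ι → mixedSpace K), ℂ) →ₗ[ℂ] 𝓢((ι → mixedSpace K), ℂ)) = LinearMap.id := by
    apply adelicTensorEnd_id_injective (K := K)
    show adelicTensorEnd _ LinearMap.id = adelicTensorEnd LinearMap.id LinearMap.id
    rw [← LinearMap.id_comp (LinearMap.id : FinSB K ι →ₗ[ℂ] FinSB K ι), adelicTensorEnd_comp, ← h1, ← h2, hN'N,
      LinearMap.id_comp, adelicTensorEnd_id]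
  refine ⟨ContinuousLinearEquiv.equivOfInverse A A' (fun φ => LinearMap.congr_fun hA'A φ)
    (fun φ => LinearMap.congr_fun hAA' φ), h1, ?_⟩
  rw [h2]
  rfl

end Literature.NumberTheory.Automorphic
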